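import Mathlib.Data.ZMod.Basic
import Mathlib.Algebra.Field.ZMod
import Mathlib.Data.Nat.Prime.Int
import Mathlib.Data.Fintype.Parity
import Mathlib.Tactic.IntervalCases
import Mathlib.Tactic.NormNum.Prime
import Mathlib.Tactic.Ring
import Mathlib.Tactic.Linarith
import Mathlib.Tactic.LinearCombination
import Mathlib.Tactic.NormNum
import Mathlib.Tactic.FieldSimp
import Mathlib.Tactic.Positivity
import Mathlib.Algebra.Order.Field.Basic
import Summits.Ventures.HSemireg.InertPrimeNonNormDescent
import HarnessLib

/-!
# Venture HSemireg — why TWO feeder types never pass (SC) on the (11,1) group: six rational numbers that are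
# not norms from `K = ℚ(ω)` (W2 numbers desk w2-vm-2, memo SCM2-SECOND-w2vm2g17.md §2b «WHY TWO TYPES NEVER PASS ON
# (11,1)») — kernel number theory

HONEST FRAMING. Lean index of the computation cell `pub-hsemireg`, widening group W2 (seat `w2-vm-2`, gen 18). ELEMENTARY
NUMBER THEORY ONLY: an inert-prime descent for the binary form `u² + uv + v²` (the norm form of `ℤ[ω]`) and six explicit
rational numbers. The toy model — the (SC) law of the W2-T1 pen's (SC-MULTI) census, feeder types, the class group label
`(A, |y|) = (11, 1)`, the cell `(3,3)` with `n_i = 2∕21`, `3^v = 1`, `W_i = 3`, and the reduction «a two-type split `3 = 1 + 2`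
of weight `W_i` realises the excess `x` iff `ρ = W_i·x∕(w₁w₂) = 3x∕2` is a norm from `K`» — enters BY VALUE (docstrings) from
the memo `widen/W2/w2vm2/SCM2-SECOND-w2vm2g17.md` v1.9 §2b (RECORD tier; the census numbers it explains are ×2 across seats and
codes: the pen w2-t1-1 g23's `kfirst` census l.23405 and this lineage's second code, memo rows 1–10). No abelian variety,
sheaf, `Ext` group or semiregularity map is constructed; (SC) is a NECESSARY law of a toy model and a passing multi-type set
is a candidate, not a rescue; W2 counts 0 ∕ 0 ∕ 0 and every door ∕ tier word are unchanged; nothing here says that HC, HC_CM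
or HC_AV holds. Theorems only (0 `def`, 0 named fact, 0 `sorry`).

WHAT THE KERNEL HOLDS.
* §1 `two_norm_step` — `2 ∣ u² + uv + v² ⇒ 2 ∣ u ∧ 2 ∣ v` (the prime `2` is inert in `ℤ[ω]`; four residues); the odd inert
  primes `p` (`−3` a non-residue mod `p`) use the tree's `InertPrimeNonNorm.eisenstein_norm_step`
  (`Summits/Ventures/HSemireg/InertPrimeNonNormDescent.lean`, ENGINE-W code B), imported.
* §2 **`no_solution_of_simple_pole`** — for a prime `p` with the step property and integers `A = p·A'`, `B` with `p ∤ A'`,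
  `p ∤ B`: `A·(u² + uv + v²) = B·s²` has NO integer solution with `s ≠ 0` (descent on `|s|`: `p ∣ s`, then `p ∣ u, v`, and
  `(u∕p, v∕p, s∕p)` solves the same equation). Equivalently `B∕A` (with `v_p = −1`) is not a norm from `K` times a square.
* §3 the six cells of record: for `k ∈ {116, …, 121}` the excess is `x_k = 2∕21 − 11∕k` and `ρ_k = 3x_k∕2` equals
  `1∕1624, 1∕546, 5∕1652, 1∕238, 3∕560, 1∕154`; each `ρ_k` has an inert prime to the power `−1`
  (`29 ∥ 1624`, `2 ∥ 546`, `59 ∥ 1652`, `17 ∥ 238`, `5 ∥ 560`, `11 ∥ 154`), so `A_k·(u² + uv + v²) ≠ B_k·s²` for `s ≠ 0`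
  (`rho116` … `rho121`), and over `ℚ`: `a² + ab + b² ≠ ρ_k` (`rho_k_not_norm`, via `u = a.num·b.den`, `v = b.num·a.den`,
  `s = a.den·b.den`).
* §4 `k_window` — the arithmetic of the window: for a natural number `k ≥ 1` the excess `2∕21 − 11∕k` is positive iff
  `116 ≤ k`; with the (SC) range `k ≤ A² = 121` of the cell, §3 covers every admissible `k` (`two_types_never_pass`).
WHAT IS NOT HERE: the (SC) law itself, the reduction to «`ρ` is a norm», the three-type witnesses at `k = 121` (norms
`847, 847, 847`; memo row 14 ∕ 18), any census. Tier of the source: the six «no» verdicts are machine ×2 across seats and codes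
(pen `kfirst` ∕ this lineage's `kfirst.py`); the norm explanation is pencil ×1 (memo §2b) — this file makes that pencil step a
kernel fact.
-/

namespace Summit.Ventures.HSemireg.TwoFeederNormObstruction

open Summit.Ventures.HSemireg.InertPrimeNonNorm (eisenstein_norm_step)

/-! ## §1 The step at the inert prime 2 (the odd inert primes: `InertPrimeNonNorm.eisenstein_norm_step`) -/

/-- **Step at `p = 2`**: `2 ∣ u² + uv + v²` forces `2 ∣ u` and `2 ∣ v` (the form is `1` at the three non-zero residues
mod `2`). [kernel] -/
theorem two_norm_step {u v : ℤ} (h : (2 : ℤ) ∣ u ^ 2 + u * v + v ^ 2) : (2 : ℤ) ∣ u ∧ (2 : ℤ) ∣ v := by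
  have hmod : ((u ^ 2 + u * v + v ^ 2 : ℤ) : ZMod 2) = 0 :=
    (ZMod.intCast_zmod_eq_zero_iff_dvd _ 2).2 (by exact_mod_cast h)
  push_cast at hmod
  have key : ∀ a b : ZMod 2, a ^ 2 + a * b + b ^ 2 = 0 → a = 0 ∧ b = 0 := by decide
  obtain ⟨hu, hv⟩ := key _ _ hmod
  exact ⟨(ZMod.intCast_zmod_eq_zero_iff_dvd u 2).1 hu, (ZMod.intCast_zmod_eq_zero_iff_dvd v 2).1 hv⟩

/-- The step at `p = 2` in the `(p : ℕ)`-cast shape used by §2. [kernel] -/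
theorem two_norm_step' : ∀ u v : ℤ, ((2 : ℕ) : ℤ) ∣ u ^ 2 + u * v + v ^ 2 → ((2 : ℕ) : ℤ) ∣ u ∧ ((2 : ℕ) : ℤ) ∣ v := by
  intro u v h
  exact_mod_cast two_norm_step (by exact_mod_cast h)

/-! ## §2 The descent: a simple pole at an inert prime forbids `A·n(u,v) = B·s²` -/

/-- **Descent lemma.** Let `p` be a prime with the step property `p ∣ u² + uv + v² ⇒ p ∣ u ∧ p ∣ v` (an inert prime of
`ℤ[ω]`), and `A = p·A'` with `p ∤ A'`, `p ∤ B`. Then `A·(u² + uv + v²) = B·s²` has no integer solution with `s ≠ 0`.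
Proof: `p ∣ B s²` gives `p ∣ s`; then `A'·n = B·p·(s∕p)²` gives `p ∣ n`, hence `p ∣ u, v`, and `(u∕p, v∕p, s∕p)` is a
solution with smaller `|s|`. [kernel] -/
theorem no_solution_of_simple_pole {p : ℕ} (hp : p.Prime)
    (hstep : ∀ u v : ℤ, (p : ℤ) ∣ u ^ 2 + u * v + v ^ 2 → (p : ℤ) ∣ u ∧ (p : ℤ) ∣ v)
    {A' B : ℤ} (hA' : ¬ (p : ℤ) ∣ A') (hB : ¬ (p : ℤ) ∣ B) :
    ∀ u v s : ℤ, s ≠ 0 → (p : ℤ) * A' * (u ^ 2 + u * v + v ^ 2) ≠ B * s ^ 2 := by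
  have hpz : Prime (p : ℤ) := Nat.prime_iff_prime_int.mp hp
  have hp0 : (p : ℤ) ≠ 0 := by exact_mod_cast hp.ne_zero
  -- strong induction on `|s|`
  suffices H : ∀ n : ℕ, ∀ u v s : ℤ, s.natAbs = n → s ≠ 0 →
      (p : ℤ) * A' * (u ^ 2 + u * v + v ^ 2) ≠ B * s ^ 2 by
    intro u v s hs; exact H _ u v s rfl hs
  intro n
  induction n using Nat.strong_induction_on with
  | _ n ih =>
    intro u v s hsn hs heq
    -- (1) `p ∣ s`
    have hps2 : (p : ℤ) ∣ B * s ^ 2 := ⟨A' * (u ^ 2 + u * v + v ^ 2), by rw [← heq]; ring⟩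
    have hps : (p : ℤ) ∣ s := by
      rcases hpz.dvd_or_dvd hps2 with h | h
      · exact absurd h hB
      · exact hpz.dvd_of_dvd_pow h
    obtain ⟨s', rfl⟩ := hps
    -- (2) `p ∣ u² + uv + v²`
    have heq' : A' * (u ^ 2 + u * v + v ^ 2) = B * (p : ℤ) * s' ^ 2 := by
      have : (p : ℤ) * (A' * (u ^ 2 + u * v + v ^ 2)) = (p : ℤ) * (B * (p : ℤ) * s' ^ 2) := by
        rw [← mul_assoc, heq]; ring
      exact mul_left_cancel₀ hp0 this
    have hpn : (p : ℤ) ∣ A' * (u ^ 2 + u * v + v ^ 2) := ⟨B * s' ^ 2, by rw [heq']; ring⟩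
    have hpn' : (p : ℤ) ∣ u ^ 2 + u * v + v ^ 2 := by
      rcases hpz.dvd_or_dvd hpn with h | h
      · exact absurd h hA'
      · exact h
    obtain ⟨hu, hv⟩ := hstep u v hpn'
    obtain ⟨u', rfl⟩ := hu
    obtain ⟨v', rfl⟩ := hv
    -- (3) the smaller solution
    have heq'' : (p : ℤ) * A' * (u' ^ 2 + u' * v' + v' ^ 2) = B * s' ^ 2 := by
      have : (p : ℤ) * ((p : ℤ) * A' * (u' ^ 2 + u' * v' + v' ^ 2)) = (p : ℤ) * (B * s' ^ 2) := by
        have e := heq'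
        linear_combination e
      exact mul_left_cancel₀ hp0 this
    have hs' : s' ≠ 0 := by
      rintro rfl; exact hs (by ring)
    have hlt : s'.natAbs < n := by
      rw [← hsn, Int.natAbs_mul]
      have h1 : 1 < (p : ℤ).natAbs := by
        rw [Int.natAbs_natCast]; exact hp.one_lt
      have h2 : 0 < s'.natAbs := Int.natAbs_pos.mpr hs'
      calc s'.natAbs = 1 * s'.natAbs := (one_mul _).symm
        _ < (p : ℤ).natAbs * s'.natAbs := Nat.mul_lt_mul_of_pos_right h1 h2
    exact ih _ hlt u' v' s' rfl hs' heq''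

/-! ## §3 The six cells of record: `ρ_k = 3∕2 · (2∕21 − 11∕k)`, `k = 116, …, 121` -/

/-- `k = 116`: `ρ = 1∕1624`, `1624 = 2³·7·29` with the inert prime `29 ∥ 1624`: `1624·(u²+uv+v²) ≠ s²` for `s ≠ 0`. [kernel] -/
theorem rho116 (u v s : ℤ) (hs : s ≠ 0) : 1624 * (u ^ 2 + u * v + v ^ 2) ≠ s ^ 2 := by
  have h3 : ¬ IsSquare ((-3 : ℤ) : ZMod 29) := by decide
  have h := no_solution_of_simple_pole (p := 29) (by norm_num)
    (fun u v huv => eisenstein_norm_step (by norm_num) (by norm_num) h3 huv)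
    (A' := 56) (B := 1) (by norm_num) (by norm_num) u v s hs
  intro e; apply h; push_cast; linear_combination e

/-- `k = 117`: `ρ = 1∕546`, `546 = 2·3·7·13` with the inert prime `2 ∥ 546`: `546·(u²+uv+v²) ≠ s²` for `s ≠ 0`. [kernel] -/
theorem rho117 (u v s : ℤ) (hs : s ≠ 0) : 546 * (u ^ 2 + u * v + v ^ 2) ≠ s ^ 2 := by
  have h := no_solution_of_simple_pole (p := 2) (by norm_num) two_norm_step'
    (A' := 273) (B := 1) (by norm_num) (by norm_num) u v s hs
  intro e; apply h; push_cast; linear_combination e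

/-- `k = 118`: `ρ = 5∕1652`, `1652 = 2²·7·59` with the inert prime `59 ∥ 1652`, `59 ∤ 5`: `1652·(u²+uv+v²) ≠ 5·s²` for
`s ≠ 0`. [kernel] -/
theorem rho118 (u v s : ℤ) (hs : s ≠ 0) : 1652 * (u ^ 2 + u * v + v ^ 2) ≠ 5 * s ^ 2 := by
  have h3 : ¬ IsSquare ((-3 : ℤ) : ZMod 59) := by decide
  have h := no_solution_of_simple_pole (p := 59) (by norm_num)
    (fun u v huv => eisenstein_norm_step (by norm_num) (by norm_num) h3 huv)
    (A' := 28) (B := 5) (by norm_num) (by norm_num) u v s hs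
  intro e; apply h; push_cast; linear_combination e

/-- `k = 119`: `ρ = 1∕238`, `238 = 2·7·17` with the inert prime `17 ∥ 238`: `238·(u²+uv+v²) ≠ s²` for `s ≠ 0`. [kernel] -/
theorem rho119 (u v s : ℤ) (hs : s ≠ 0) : 238 * (u ^ 2 + u * v + v ^ 2) ≠ s ^ 2 := by
  have h3 : ¬ IsSquare ((-3 : ℤ) : ZMod 17) := by decide
  have h := no_solution_of_simple_pole (p := 17) (by norm_num)
    (fun u v huv => eisenstein_norm_step (by norm_num) (by norm_num) h3 huv)
    (A' := 14) (B := 1) (by norm_num) (by norm_num) u v s hs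
  intro e; apply h; push_cast; linear_combination e

/-- `k = 120`: `ρ = 3∕560`, `560 = 2⁴·5·7` with the inert prime `5 ∥ 560`, `5 ∤ 3`: `560·(u²+uv+v²) ≠ 3·s²` for `s ≠ 0`.
[kernel] -/
theorem rho120 (u v s : ℤ) (hs : s ≠ 0) : 560 * (u ^ 2 + u * v + v ^ 2) ≠ 3 * s ^ 2 := by
  have h3 : ¬ IsSquare ((-3 : ℤ) : ZMod 5) := by decide
  have h := no_solution_of_simple_pole (p := 5) (by norm_num)
    (fun u v huv => eisenstein_norm_step (by norm_num) (by norm_num) h3 huv)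
    (A' := 112) (B := 3) (by norm_num) (by norm_num) u v s hs
  intro e; apply h; push_cast; linear_combination e

/-- `k = 121 = A²`: `ρ = 1∕154`, `154 = 2·7·11` with the inert prime `11 ∥ 154`: `154·(u²+uv+v²) ≠ s²` for `s ≠ 0`
(the memo's worked case: «`154 = 2·7·11`, where `2` and `11 ≡ 2 (mod 3)` occur to an odd power — not a norm»). [kernel] -/
theorem rho121 (u v s : ℤ) (hs : s ≠ 0) : 154 * (u ^ 2 + u * v + v ^ 2) ≠ s ^ 2 := by
  have h3 : ¬ IsSquare ((-3 : ℤ) : ZMod 11) := by decide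
  have h := no_solution_of_simple_pole (p := 11) (by norm_num)
    (fun u v huv => eisenstein_norm_step (by norm_num) (by norm_num) h3 huv)
    (A' := 14) (B := 1) (by norm_num) (by norm_num) u v s hs
  intro e; apply h; push_cast; linear_combination e

/-! ### Over `ℚ`: `a² + ab + b² ≠ ρ_k` -/

/-- Clearing denominators: if `a² + ab + b² = B∕A` over `ℚ` (`A ≠ 0`) then `A·(u²+uv+v²) = B·s²` for the integers
`u = a.num·b.den`, `v = b.num·a.den`, `s = a.den·b.den ≠ 0`. [kernel] -/
theorem clear_denominators {a b : ℚ} {A B : ℤ} (hA : A ≠ 0) (h : a ^ 2 + a * b + b ^ 2 = (B : ℚ) / A) :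
    ∃ u v s : ℤ, s ≠ 0 ∧ A * (u ^ 2 + u * v + v ^ 2) = B * s ^ 2 := by
  refine ⟨a.num * b.den, b.num * a.den, a.den * b.den, ?_, ?_⟩
  · exact mul_ne_zero (by exact_mod_cast a.den_nz) (by exact_mod_cast b.den_nz)
  · have ha : (a.num : ℚ) / a.den = a := Rat.num_div_den a
    have hb : (b.num : ℚ) / b.den = b := Rat.num_div_den b
    have had : (a.den : ℚ) ≠ 0 := by exact_mod_cast a.den_nz
    have hbd : (b.den : ℚ) ≠ 0 := by exact_mod_cast b.den_nz
    have hAq : (A : ℚ) ≠ 0 := by exact_mod_cast hA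
    have key : (A : ℚ) * ((a.num * b.den : ℚ) ^ 2 + (a.num * b.den) * (b.num * a.den) + (b.num * a.den) ^ 2)
        = B * ((a.den : ℚ) * b.den) ^ 2 := by
      have e1 : (a.num : ℚ) = a * a.den := by field_simp at ha ⊢; linarith [ha]
      have e2 : (b.num : ℚ) = b * b.den := by field_simp at hb ⊢; linarith [hb]
      rw [e1, e2]
      have h' : (A : ℚ) * (a ^ 2 + a * b + b ^ 2) = B := by
        rw [h]; field_simp
      linear_combination ((a.den : ℚ) * b.den) ^ 2 * h'
    exact_mod_cast key

/-- `ρ_116 = 1∕1624` is not of the form `a² + ab + b²` with `a, b ∈ ℚ` (not a norm from `ℚ(ω)`). [kernel] -/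
theorem rho116_not_norm (a b : ℚ) : a ^ 2 + a * b + b ^ 2 ≠ 1 / 1624 := by
  intro h
  obtain ⟨u, v, s, hs, e⟩ := clear_denominators (A := 1624) (B := 1) (by norm_num) (by rw [h]; norm_num)
  exact rho116 u v s hs (by linear_combination e)

/-- `ρ_117 = 1∕546` is not a norm from `ℚ(ω)`. [kernel] -/
theorem rho117_not_norm (a b : ℚ) : a ^ 2 + a * b + b ^ 2 ≠ 1 / 546 := by
  intro h
  obtain ⟨u, v, s, hs, e⟩ := clear_denominators (A := 546) (B := 1) (by norm_num) (by rw [h]; norm_num)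
  exact rho117 u v s hs (by linear_combination e)

/-- `ρ_118 = 5∕1652` is not a norm from `ℚ(ω)`. [kernel] -/
theorem rho118_not_norm (a b : ℚ) : a ^ 2 + a * b + b ^ 2 ≠ 5 / 1652 := by
  intro h
  obtain ⟨u, v, s, hs, e⟩ := clear_denominators (A := 1652) (B := 5) (by norm_num) (by rw [h]; norm_num)
  exact rho118 u v s hs (by linear_combination e)

/-- `ρ_119 = 1∕238` is not a norm from `ℚ(ω)`. [kernel] -/
theorem rho119_not_norm (a b : ℚ) : a ^ 2 + a * b + b ^ 2 ≠ 1 / 238 := by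
  intro h
  obtain ⟨u, v, s, hs, e⟩ := clear_denominators (A := 238) (B := 1) (by norm_num) (by rw [h]; norm_num)
  exact rho119 u v s hs (by linear_combination e)

/-- `ρ_120 = 3∕560` is not a norm from `ℚ(ω)`. [kernel] -/
theorem rho120_not_norm (a b : ℚ) : a ^ 2 + a * b + b ^ 2 ≠ 3 / 560 := by
  intro h
  obtain ⟨u, v, s, hs, e⟩ := clear_denominators (A := 560) (B := 3) (by norm_num) (by rw [h]; norm_num)
  exact rho120 u v s hs (by linear_combination e)

/-- `ρ_121 = 1∕154` is not a norm from `ℚ(ω)`. [kernel] -/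
theorem rho121_not_norm (a b : ℚ) : a ^ 2 + a * b + b ^ 2 ≠ 1 / 154 := by
  intro h
  obtain ⟨u, v, s, hs, e⟩ := clear_denominators (A := 154) (B := 1) (by norm_num) (by rw [h]; norm_num)
  exact rho121 u v s hs (by linear_combination e)

/-- The six values are the `ρ_k = 3∕2·(2∕21 − 11∕k)` of the memo, `k = 116, …, 121`. [kernel, arithmetic] -/
theorem rho_values :
    (3 : ℚ) / 2 * (2 / 21 - 11 / 116) = 1 / 1624 ∧ (3 : ℚ) / 2 * (2 / 21 - 11 / 117) = 1 / 546 ∧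
    (3 : ℚ) / 2 * (2 / 21 - 11 / 118) = 5 / 1652 ∧ (3 : ℚ) / 2 * (2 / 21 - 11 / 119) = 1 / 238 ∧
    (3 : ℚ) / 2 * (2 / 21 - 11 / 120) = 3 / 560 ∧ (3 : ℚ) / 2 * (2 / 21 - 11 / 121) = 1 / 154 := by
  norm_num

/-- **Summary over the window**: for every `k ∈ {116, …, 121}`, `ρ_k = 3∕2·(2∕21 − 11∕k)` is not of the form
`a² + ab + b²`, `a, b ∈ ℚ`. [kernel] -/
theorem rho_not_norm (k : ℕ) (hk : 116 ≤ k ∧ k ≤ 121) (a b : ℚ) :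
    a ^ 2 + a * b + b ^ 2 ≠ (3 : ℚ) / 2 * (2 / 21 - 11 / k) := by
  obtain ⟨h1, h2⟩ := hk
  interval_cases k
  · push_cast; rw [rho_values.1]; exact rho116_not_norm a b
  · push_cast; rw [rho_values.2.1]; exact rho117_not_norm a b
  · push_cast; rw [rho_values.2.2.1]; exact rho118_not_norm a b
  · push_cast; rw [rho_values.2.2.2.1]; exact rho119_not_norm a b
  · push_cast; rw [rho_values.2.2.2.2.1]; exact rho120_not_norm a b
  · push_cast; rw [rho_values.2.2.2.2.2]; exact rho121_not_norm a b

/-! ## §4 The window `116 ≤ k ≤ 121` -/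

/-- **The (SC) window of the cell `(3,3)` on `(11,1)`**: for `k ≥ 1` the excess `x = 2∕21 − 11∕k` is positive iff
`116 ≤ k` (`2k > 231`); with the (SC) range `k ≤ A² = 121` this leaves `k ∈ {116, …, 121}`. [kernel, arithmetic] -/
theorem k_window (k : ℕ) (hk1 : 1 ≤ k) :
    (0 : ℚ) < 2 / 21 - 11 / k ↔ 116 ≤ k := by
  have hkq : (0 : ℚ) < k := by exact_mod_cast hk1
  have hk0 : (k : ℚ) ≠ 0 := hkq.ne'
  have key : (2 : ℚ) / 21 - 11 / k = (2 * k - 231) / (21 * k) := by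
    field_simp
    ring
  rw [key]
  constructor
  · intro h
    have h21 : (0 : ℚ) < 21 * k := by positivity
    have ha : (0 : ℚ) < 2 * k - 231 := (div_pos_iff_of_pos_right h21).mp h
    have : (231 : ℚ) < 2 * k := by linarith
    have : (231 : ℕ) < 2 * k := by exact_mod_cast this
    omega
  · intro h
    have hk' : (116 : ℚ) ≤ k := by exact_mod_cast h
    apply div_pos <;> linarith

/-- **Net statement** (the memo's sentence as one theorem): for every `k` in the (SC) range `1 ≤ k ≤ 121` with positive
excess, `ρ_k = 3∕2·(2∕21 − 11∕k)` is not a norm `a² + ab + b²` from `ℚ(ω)` — so no two-type split `3 = 1 + 2` realises the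
excess on the `(11,1)` cell `(3,3)` (the reduction to the norm condition enters by value). [kernel] -/
theorem two_types_never_pass (k : ℕ) (hk1 : 1 ≤ k) (hk2 : k ≤ 121) (hx : (0 : ℚ) < 2 / 21 - 11 / k) (a b : ℚ) :
    a ^ 2 + a * b + b ^ 2 ≠ (3 : ℚ) / 2 * (2 / 21 - 11 / k) :=
  rho_not_norm k ⟨(k_window k hk1).1 hx, hk2⟩ a b

end Summit.Ventures.HSemireg.TwoFeederNormObstruction
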